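import Literature.NumberTheory.EllipticCurves.TorsionFilAtCyclicOfFrobeniusTraceProofs
import Literature.NumberTheory.EllipticCurves.TorsionFilAtCyclicOrdinaryProofs
import Literature.NumberTheory.EllipticCurves.FrobeniusTraceBaseChange
import Literature.NumberTheory.EllipticCurves.IsogenyFrobeniusTraceProofs
import Summits.BirchSwinnertonDyer.BirchSwinnertonDyer.Theorems.RamifiedSevenEllipticUnitsTwistTransportPinned
import Summits.BirchSwinnertonDyer.BirchSwinnertonDyer.Theorems.GoldfeldGoodTwistsX049
import Summits.BirchSwinnertonDyer.BirchSwinnertonDyer.Theorems.PrintCf2SplitBadTwoCMPrimaryLocalPinning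
import HarnessLib

/-!
# The good curve `E₀ = cm7_K` at a split place `v ∣ 2`: good ORDINARY reduction (an ordinary point of `E₀(K̄_v)`)

Crux `stmt-BirchSwinnertonDyer-20368` (`PrintCf2.SplitBadTwoRankOneOfFacts`), road α, LEAD ruling (R-ET) 2026-08-29, brick (ET-v)
(«`2 • res_{D_v}(e_* κ_n(Q)) = 0`», hfin-free). The reduction-theoretic input of Greenberg's argument (LNM 1716 §2 Prop. 2.2) is
read on the GOOD curve `E₀ = cm7_K` (`49a1` over `K`), to which `E = W_K` (`C • W = cm7^{(d)}`) is isomorphic over `K̄_v`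
(`exists_localUntwist`). This file supplies, for `K` imaginary quadratic with `2 = v·v̄` split:
* `hasGoodReductionAt_cm7_of_two_mem` — `cm7_K` has good reduction at `v ∋ 2` (`Δ(49a1) = −7³`, `7 ∉ v`);
* `not_two_dvd_frobeniusTraceAt_cm7` — `a_v(cm7_K) = a_2(49a1) = 1` is odd (`f(v|2) = 1`, Dickson `D₁ = X`);
* `exists_ordinaryPoint_cm7` — hence some `2`-torsion point of `E₀(K̄_v)` lies outside the kernel of reduction `E₀,₁(K̄_v)`
  (Greenberg's «good ordinary»), the hypothesis of the tree's `exists_generator_localKernelOfReduction_torsion` /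
  `exists_nsmul_eq_of_mem_localKernelOfReduction` (`E₀,₁ ∩ E₀[2^k]` cyclic of order `2^k`, `E₀,₁` divisible).
No definition, no named fact, no `sorry`. BSD is not proved by any of this.

References: [GreenbergLNM1716] §1 p. 62, §2 Prop. 2.2; [SilvermanAEC2009] V.2.3.1, VII.2.1, VII.5.1; [Cremona1997] Table 1 (49a1:
`a_2 = 1`).
-/

noncomputable section

open scoped Classical

set_option linter.dupNamespace false

namespace Summit.BirchSwinnertonDyer.BirchSwinnertonDyer.Theorems.PrintCf2.CMPrimes

open NumberField IsDedekindDomain Field WeierstrassCurve Literature.NumberTheory.EllipticCurves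
  Summit.BirchSwinnertonDyer.BirchSwinnertonDyer.Theorems.RamifiedSevenEllipticUnits

variable {K : Type} [Field K] [NumberField K]

omit [NumberField K] in
/-- `7 ∉ v` for a place `v ∋ 2` (`7 − 3·2 = 1`). [folklore] -/
theorem seven_notMem_of_two_mem {v : HeightOneSpectrum (𝓞 K)} (hv : ((2 : ℕ) : 𝓞 K) ∈ v.asIdeal) :
    ((7 : ℕ) : 𝓞 K) ∉ v.asIdeal := by
  intro h7
  apply v.isPrime.ne_top
  rw [Ideal.eq_top_iff_one]
  have h : ((7 : ℕ) : 𝓞 K) - 3 * ((2 : ℕ) : 𝓞 K) = 1 := by push_cast; ring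
  rw [← h]
  exact v.asIdeal.sub_mem h7 (v.asIdeal.mul_mem_left _ hv)

/-- **`cm7_K` has good reduction at every `v ∋ 2`** (`Δ(49a1) = −7³` is a `v`-unit). [cite: Cremona1997, Table 1 (curve 49a1)] -/
theorem hasGoodReductionAt_cm7_of_two_mem {v : HeightOneSpectrum (𝓞 K)} (hv : ((2 : ℕ) : 𝓞 K) ∈ v.asIdeal) :
    (cm7.baseChange K).HasGoodReductionAt v :=
  TwistTransport.hasGoodReductionAt_baseChange_cm7 v (seven_notMem_of_two_mem hv)

/-- **`a_v(cm7_K)` is odd at a split `v ∣ 2`**: `f(v|2) = 1`, so `a_v(cm7_K) = D₁(a_2(49a1)) = a_2(49a1) = 1`.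
[cite: SilvermanAEC2009, Thm. V.2.3.1] [cite: Cremona1997, Table 1 (curve 49a1, a_2 = 1)] -/
theorem frobeniusTraceAt_cm7_eq_one (hK2 : Module.finrank ℚ K = 2) {v vbar : HeightOneSpectrum (𝓞 K)}
    (hv : ((2 : ℕ) : 𝓞 K) ∈ v.asIdeal) (hvbar : ((2 : ℕ) : 𝓞 K) ∈ vbar.asIdeal) (hne : vbar ≠ v) :
    (cm7.baseChange K).frobeniusTraceAt v = 1 := by
  haveI : Fact (Nat.Prime 2) := ⟨Nat.prime_two⟩
  haveI : cm7.IsGloballyMinimal := GoldfeldGoodTwists.isGloballyMinimal_cm7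
  set u : HeightOneSpectrum (𝓞 ℚ) := v.under (𝓞 ℚ) with hu
  have h2u : ((2 : ℕ) : 𝓞 ℚ) ∈ u.asIdeal := by
    change algebraMap (𝓞 ℚ) (𝓞 K) ((2 : ℕ) : 𝓞 ℚ) ∈ v.asIdeal
    rwa [map_natCast]
  have hgen2 : ((Rat.HeightOneSpectrum.primesEquiv u : Nat.Primes) : ℕ) = 2 := by
    rw [show ((Rat.HeightOneSpectrum.primesEquiv u : Nat.Primes) : ℕ) = Rat.HeightOneSpectrum.natGenerator u from rfl,
      ← Nat.prime_dvd_prime_iff_eq (Rat.HeightOneSpectrum.prime_natGenerator u) Nat.prime_two,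
      Rat.HeightOneSpectrum.natGenerator_dvd_iff, ← map_natCast (Rat.IsIntegralClosure.intEquiv (𝓞 ℚ)) 2,
      Ideal.apply_mem_of_equiv_iff]
    exact h2u
  have hgood : cm7.HasGoodReductionAt u :=
    (hasGoodReductionAtPrime_primesEquiv_iff_holds cm7 u 2 hgen2).mp GoldfeldGoodTwists.hasGoodReductionAtPrime_cm7_two
  have hf : v.asIdeal.inertiaDeg (𝓞 ℚ) = 1 := inertiaDeg_eq_one_of_ne_two K hK2 hv hvbar hne
  rw [frobeniusTraceAt_baseChange_eq_eval_dickson cm7 K (w := v) (v := u) rfl hgood, hf, Polynomial.dickson_one,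
    Polynomial.eval_X, frobeniusTraceAt_eq_frobeniusTrace cm7 u, hgen2, GoldfeldGoodTwists.frobeniusTrace_cm7_two]

/-- `a_v(cm7_K)` is odd. [cite: Cremona1997, Table 1 (curve 49a1, a_2 = 1)] -/
theorem not_two_dvd_frobeniusTraceAt_cm7 (hK2 : Module.finrank ℚ K = 2) {v vbar : HeightOneSpectrum (𝓞 K)}
    (hv : ((2 : ℕ) : 𝓞 K) ∈ v.asIdeal) (hvbar : ((2 : ℕ) : 𝓞 K) ∈ vbar.asIdeal) (hne : vbar ≠ v) :
    ¬ ((2 : ℤ) ∣ (cm7.baseChange K).frobeniusTraceAt v) := by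
  rw [frobeniusTraceAt_cm7_eq_one hK2 hv hvbar hne]; decide

/-- **An ordinary point of `E₀(K̄_v)`** (`E₀ = cm7_K`, `v ∣ 2` split): some `2`-torsion point of `E₀(K̄_v)` lies outside the
kernel of reduction `E₀,₁(K̄_v)` — Greenberg's «good ORDINARY reduction at `v`» in the form the tree's reduction theory
(`exists_generator_localKernelOfReduction_torsion`, `exists_nsmul_eq_of_mem_localKernelOfReduction`) consumes.
[cite: GreenbergLNM1716, §1 p. 62] [cite: SilvermanAEC2009, Thm. V.3.1(a) and Prop. VII.2.1] -/
theorem exists_ordinaryPoint_cm7 (hK2 : Module.finrank ℚ K = 2) {v vbar : HeightOneSpectrum (𝓞 K)}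
    (hv : ((2 : ℕ) : 𝓞 K) ∈ v.asIdeal) (hvbar : ((2 : ℕ) : 𝓞 K) ∈ vbar.asIdeal) (hne : vbar ≠ v) :
    haveI : Fact (Nat.Prime 2) := ⟨Nat.prime_two⟩
    ∃ P : localPoints (cm7.baseChange K) (v.adicCompletion K), ((2 : ℕ) : ℤ) • P = 0 ∧
      P ∉ (cm7.baseChange K).localKernelOfReduction v := by
  haveI : Fact (Nat.Prime 2) := ⟨Nat.prime_two⟩
  haveI : (cm7.baseChange K).IsElliptic := by rw [baseChange]; infer_instance
  exact (cm7.baseChange K).exists_ordinaryPoint_local_of_not_dvd_frobeniusTraceAt v (hasGoodReductionAt_cm7_of_two_mem hv) hv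
    (not_two_dvd_frobeniusTraceAt_cm7 hK2 hv hvbar hne)

end Summit.BirchSwinnertonDyer.BirchSwinnertonDyer.Theorems.PrintCf2.CMPrimes

end
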